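import Summits.AnomalousDissipation.AnomalousDissipation.Theorems.SawtoothPulseCascadeK1LocalisedCascadeCutoffSup
import Summits.AnomalousDissipation.AnomalousDissipation.Theorems.SawtoothPulseCascadeK1LocalisedCascadeFibreWindowL2

/-!
# K1loc, line `Spectral` / thin start — helper: THE HALF-STEP WINDOW INEQUALITY, SUP FORM OF THE CUT-OFF (S-D, «HalfStepSup»)

Helper file of the prover lane on the crux `K1LocalisedCascade` (stmt-AnomalousDissipation-19491), route
`SawtoothPulseCascade` (S-D fibre ledger; early phases of the K1loc′ chain, `δ` small).  Fourth bookkeeping of the mid-band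
term: the cut-off `g^mid_n = ψ_n ⋆ twist(γU_j) n` is bounded UNIFORMLY by the `ℓ¹` norm of the chirp's coefficients on the
support of `ψ_n` (`…CutoffSup.norm_circleCutoff_twist_cascade_le`: `ρ_n = #{m ∈ Sψ_n : N_j ∣ m}·2/(πD′_n) + #Sψ_n·|n|G(2e^{1/2}−1)δ_j/N_j`
when the multiples of `N_j` in `Sψ_n` keep the distance `N_jD′_n` from `±nG`), and the input is paid in `L²` fibre by fibre:
* §1 `sum_sq_norm_mid_le_sup` (any `d`): `Σ_{k∈W}‖𝓕(g^mid_{k_i}(x_j)A^i_{k_i}θ₁)(k)‖² ≤ Σ_{n∈F} ρ_n²·∫‖A^i_nθ₁‖²` for per-fibre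
  constant majorants `‖g^mid_n‖ ≤ ρ_n`;
* §2 `sum_window_sq_norm_comp_shearMap_le_sup` (two-torus): the window lemma with this mid-band term;
* §3 **`sum_window_sq_norm_halfStep_twist_sup_le`**: the half-step for both axes and a generic continuous input `b`
  (hypotheses of `…HalfStepSieve` with `D′ ≥ 1`):
  `Σ_{k∈W}‖𝓕(b∘Φ)(k)‖² ≤ (√(Σ_{n∈F}ρ_n²∫‖A^i_nT‖²) + √(Σ_{n∈F}∫‖A^i_n(b − T)‖²))²`, `T = Σ_l χ(l)A^{i′}_l b`.
No kernel norms, no envelope, no sup of the input; for a plateau `|m| ≤ p` at distance `D` from `±nG`, `ρ_n ≈ (2/π)(2p/D)`.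
No definitions; no statement about the crux. [cite: Grafakos2014, Prop. 3.1.2 (5) and Prop. 3.2.7 (3)] [problem: turb]
-/

-- `Summit.<Summit>.<Problem>`: single-conjunct summit, the duplicate namespace segment is deliberate.
set_option linter.dupNamespace false

noncomputable section

namespace Summit.AnomalousDissipation.AnomalousDissipation.Theorems.SawtoothPulseCascade.K1Window

open MeasureTheory Set Filter Topology UnitAddTorus Function Complex
open scoped Real
open Literature.Analysis Literature.Analysis.FunctionSpaces Literature.Analysis.FunctionSpaces.Torus Literature.Analysis.FluidPDE
open Literature.Analysis.FluidPDE.ShearStage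
open Literature.Analysis.FluidPDE.SawtoothCascade Literature.Analysis.FluidPDE.SawtoothCascade.CascadeParams
open Summit.AnomalousDissipation.AnomalousDissipation.Theorems.SawtoothPulseCascade.K1Start

section General

variable {d : Type*} [Fintype d] [DecidableEq d]

/-! ## §1 The mid-band term with per-fibre constant majorants -/

/-- **Mid-band term, sup form**: if `‖g^mid_n(b)‖ ≤ ρ_n` on the fibres met by `W`, then
`Σ_{k∈W}‖𝓕(g^mid_{k_i}(x_j)·A^i_{k_i}θ₁)(k)‖² ≤ Σ_{n∈F} ρ_n²·∫‖A^i_nθ₁‖²` (Bessel on each fibre and the pointwise bound).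
[cite: Grafakos2014, Prop. 3.2.7 (3)] -/
theorem sum_sq_norm_mid_le_sup {θ₁ : UnitAddTorus d → ℂ} (hθ₁ : Continuous θ₁) {i j : d} (hij : i ≠ j)
    (W : Finset (d → ℤ)) (gmid : ℤ → UnitAddCircle → ℂ) (hgmid : ∀ n, Continuous (gmid n)) {ρ : ℤ → ℝ}
    (hρ : ∀ k ∈ W, ∀ b : UnitAddCircle, ‖gmid (k i) b‖ ≤ ρ (k i)) :
    ∑ k ∈ W, ‖mFourierCoeff (fun x => gmid (k i) (x j) *
        ∫ s : UnitAddCircle, (fourier (-(k i)) s : ℂ) • θ₁ (x + Pi.single i s)) k‖ ^ 2 ≤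
      ∑ n ∈ W.image (fun k => k i),
        ρ n ^ 2 * ∫ x : UnitAddTorus d, ‖∫ s : UnitAddCircle, (fourier (-n) s : ℂ) • θ₁ (x + Pi.single i s)‖ ^ 2 := by
  classical
  have _ := hij
  set A₁ : ℤ → UnitAddTorus d → ℂ := fun n x =>
    ∫ s : UnitAddCircle, (fourier (-n) s : ℂ) • θ₁ (x + Pi.single i s) with hA₁
  set H₁ : ℤ → UnitAddTorus d → ℂ := fun n x => gmid n (x j) * A₁ n x with hH₁
  have hA₁c : ∀ n, Continuous (A₁ n) := fun n => continuous_twistedAxisAvg hθ₁ i n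
  have hH₁c : ∀ n, Continuous (H₁ n) := fun n => ((hgmid n).comp (continuous_apply j)).mul (hA₁c n)
  set F : Finset ℤ := W.image fun k => k i with hF
  have hmaps : ∀ k ∈ W, k i ∈ F := fun k hk => Finset.mem_image_of_mem _ hk
  have hfib : ∑ k ∈ W, ‖mFourierCoeff (H₁ (k i)) k‖ ^ 2 ≤ ∑ n ∈ F, ∫ x : UnitAddTorus d, ‖H₁ n x‖ ^ 2 := by
    rw [← Finset.sum_fiberwise_of_maps_to hmaps]
    refine Finset.sum_le_sum fun n hn => ?_
    calc ∑ k ∈ W with k i = n, ‖mFourierCoeff (H₁ (k i)) k‖ ^ 2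
        = ∑ k ∈ W with k i = n, ‖mFourierCoeff (H₁ n) k‖ ^ 2 :=
          Finset.sum_congr rfl fun k hk => by rw [(Finset.mem_filter.mp hk).2]
      _ ≤ ∫ x : UnitAddTorus d, ‖H₁ n x‖ ^ 2 := sum_sq_norm_mFourierCoeff_le_integral (hH₁c n) _
  have hρF : ∀ n ∈ F, ∀ b : UnitAddCircle, ‖gmid n b‖ ≤ ρ n := by
    intro n hn b; obtain ⟨k, hk, rfl⟩ := Finset.mem_image.mp hn; exact hρ k hk b
  have hle : ∀ n ∈ F, ∫ x : UnitAddTorus d, ‖H₁ n x‖ ^ 2 ≤ ρ n ^ 2 * ∫ x : UnitAddTorus d, ‖A₁ n x‖ ^ 2 := by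
    intro n hn
    have hpt : ∀ x : UnitAddTorus d, ‖H₁ n x‖ ^ 2 ≤ ρ n ^ 2 * ‖A₁ n x‖ ^ 2 := by
      intro x
      simp only [hH₁, norm_mul, mul_pow]
      exact mul_le_mul_of_nonneg_right (pow_le_pow_left₀ (norm_nonneg _) (hρF n hn (x j)) 2) (sq_nonneg _)
    rw [← integral_const_mul]
    exact integral_mono ((continuous_norm.comp (hH₁c n)).pow 2).integrable_unitAddTorus
      (continuous_const.mul ((continuous_norm.comp (hA₁c n)).pow 2)).integrable_unitAddTorus hpt
  exact hfib.trans (Finset.sum_le_sum hle)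

end General

/-! ## §2 The window lemma, sup form (two-torus) -/

/-- **THE WINDOW LEMMA, sup mid-band form** (two-torus).  Data as in `…FibreWindowL2.sum_window_sq_norm_comp_shearMap_le_fibreL2`,
with per-fibre constant majorants `‖g^mid_n‖ ≤ ρ_n` instead of `L²` masses and input sups:
`Σ_{k∈W}‖𝓕((θ₁+θ₂)∘Φ)(k)‖² ≤ (√(Σ_{n∈F}ρ_n²∫‖A^i_nθ₁‖²) + √(Σ_{n∈F}∫‖A^i_nθ₂‖²))²`.
[cite: Grafakos2014, Prop. 3.1.2 (5) and Prop. 3.2.7 (3)] -/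
theorem sum_window_sq_norm_comp_shearMap_le_sup {θ₁ θ₂ : UnitAddTorus (Fin 2) → ℂ} (hθ₁ : Continuous θ₁)
    (hθ₁s : Summable fun k => ‖mFourierCoeff θ₁ k‖) (hθ₂ : Continuous θ₂) {i j : Fin 2} (hij : i ≠ j)
    (P : ShearProfile)
    (W : Finset (Fin 2 → ℤ)) (gmid grest : ℤ → UnitAddCircle → ℂ) (hgmid : ∀ n, Continuous (gmid n))
    (hgrest : ∀ n, Continuous (grest n)) (hsplit : ∀ k ∈ W, ∀ b, twist P (k i) b = gmid (k i) b + grest (k i) b)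
    (hsep : ∀ k ∈ W, ∀ m : ℤ, fourierCoeff (grest (k i)) m * mFourierCoeff θ₁ (k - Pi.single j m) = 0)
    {ρ : ℤ → ℝ} (hρ : ∀ k ∈ W, ∀ b : UnitAddCircle, ‖gmid (k i) b‖ ≤ ρ (k i)) :
    ∑ k ∈ W, ‖mFourierCoeff ((fun x => θ₁ x + θ₂ x) ∘ shearMap i j P) k‖ ^ 2 ≤
      (Real.sqrt (∑ n ∈ W.image (fun k => k i),
          ρ n ^ 2 * ∫ x : UnitAddTorus (Fin 2), ‖∫ s : UnitAddCircle, (fourier (-n) s : ℂ) • θ₁ (x + Pi.single i s)‖ ^ 2) +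
        Real.sqrt (∑ n ∈ W.image (fun k => k i),
          ∫ x : UnitAddTorus (Fin 2), ‖∫ s : UnitAddCircle, (fourier (-n) s : ℂ) • θ₂ (x + Pi.single i s)‖ ^ 2)) ^ 2 := by
  classical
  set H₁ : ℤ → UnitAddTorus (Fin 2) → ℂ := fun n x => gmid n (x j) *
    ∫ s : UnitAddCircle, (fourier (-n) s : ℂ) • θ₁ (x + Pi.single i s) with hH₁
  set H₂ : ℤ → UnitAddTorus (Fin 2) → ℂ := fun n x => twist P n (x j) *
    ∫ s : UnitAddCircle, (fourier (-n) s : ℂ) • θ₂ (x + Pi.single i s) with hH₂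
  have hH₂c : ∀ n, Continuous (H₂ n) := fun n =>
    ((continuous_twist P n).comp (continuous_apply j)).mul (continuous_twistedAxisAvg hθ₂ i n)
  have hcoef : ∀ k ∈ W, mFourierCoeff ((fun x => θ₁ x + θ₂ x) ∘ shearMap i j P) k =
      mFourierCoeff (H₁ (k i)) k + mFourierCoeff (H₂ (k i)) k := by
    intro k hk
    have hsum : ((fun x => θ₁ x + θ₂ x) ∘ shearMap i j P) = (θ₁ ∘ shearMap i j P) + (θ₂ ∘ shearMap i j P) := by
      funext x; rfl
    rw [hsum, Torus.mFourierCoeff_add (F := ℂ) ((hθ₁.comp (continuous_shearMap i j P)).integrable_unitAddTorus)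
      ((hθ₂.comp (continuous_shearMap i j P)).integrable_unitAddTorus),
      mFourierCoeff_comp_shearMap_eq_mid hθ₁ hθ₁s hij P (hgmid (k i)) (hgrest (k i)) k (hsplit k hk) (hsep k hk),
      mFourierCoeff_comp_shearMap_eq_chirp hθ₂ hij P k]
  have hM : ∑ k ∈ W, ‖mFourierCoeff ((fun x => θ₁ x + θ₂ x) ∘ shearMap i j P) k‖ ^ 2 ≤
      (Real.sqrt (∑ k ∈ W, ‖mFourierCoeff (H₁ (k i)) k‖ ^ 2) +
        Real.sqrt (∑ k ∈ W, ‖mFourierCoeff (H₂ (k i)) k‖ ^ 2)) ^ 2 := by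
    have h1 : ∑ k ∈ W, ‖mFourierCoeff ((fun x => θ₁ x + θ₂ x) ∘ shearMap i j P) k‖ ^ 2 ≤
        ∑ k ∈ W, (‖mFourierCoeff (H₁ (k i)) k‖ + ‖mFourierCoeff (H₂ (k i)) k‖) ^ 2 := by
      refine Finset.sum_le_sum fun k hk => ?_
      rw [hcoef k hk]
      exact pow_le_pow_left₀ (norm_nonneg _) (norm_add_le _ _) 2
    have h2 := SpectralLeakage.sqrt_sum_add_sq_le W (a := fun k => ‖mFourierCoeff (H₁ (k i)) k‖)
      (b := fun k => ‖mFourierCoeff (H₂ (k i)) k‖) (fun k _ => norm_nonneg _) (fun k _ => norm_nonneg _)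
    have h0 : 0 ≤ ∑ k ∈ W, (‖mFourierCoeff (H₁ (k i)) k‖ + ‖mFourierCoeff (H₂ (k i)) k‖) ^ 2 :=
      Finset.sum_nonneg fun k _ => sq_nonneg _
    calc ∑ k ∈ W, ‖mFourierCoeff ((fun x => θ₁ x + θ₂ x) ∘ shearMap i j P) k‖ ^ 2
        ≤ ∑ k ∈ W, (‖mFourierCoeff (H₁ (k i)) k‖ + ‖mFourierCoeff (H₂ (k i)) k‖) ^ 2 := h1
      _ = (Real.sqrt (∑ k ∈ W, (‖mFourierCoeff (H₁ (k i)) k‖ + ‖mFourierCoeff (H₂ (k i)) k‖) ^ 2)) ^ 2 :=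
          (Real.sq_sqrt h0).symm
      _ ≤ _ := pow_le_pow_left₀ (Real.sqrt_nonneg _) h2 2
  have hA := sum_sq_norm_mid_le_sup hθ₁ hij W gmid hgmid hρ
  have hB : ∑ k ∈ W, ‖mFourierCoeff (H₂ (k i)) k‖ ^ 2 ≤ ∑ n ∈ W.image (fun k => k i),
      ∫ x : UnitAddTorus (Fin 2), ‖∫ s : UnitAddCircle, (fourier (-n) s : ℂ) • θ₂ (x + Pi.single i s)‖ ^ 2 := by
    set F : Finset ℤ := W.image fun k => k i with hF
    have hmaps : ∀ k ∈ W, k i ∈ F := fun k hk => Finset.mem_image_of_mem _ hk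
    rw [← Finset.sum_fiberwise_of_maps_to hmaps]
    refine Finset.sum_le_sum fun n hn => ?_
    calc ∑ k ∈ W with k i = n, ‖mFourierCoeff (H₂ (k i)) k‖ ^ 2
        = ∑ k ∈ W with k i = n, ‖mFourierCoeff (H₂ n) k‖ ^ 2 :=
          Finset.sum_congr rfl fun k hk => by rw [(Finset.mem_filter.mp hk).2]
      _ ≤ ∫ x : UnitAddTorus (Fin 2), ‖H₂ n x‖ ^ 2 := sum_sq_norm_mFourierCoeff_le_integral (hH₂c n) _
      _ = ∫ x : UnitAddTorus (Fin 2), ‖∫ s : UnitAddCircle, (fourier (-n) s : ℂ) • θ₂ (x + Pi.single i s)‖ ^ 2 :=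
          integral_congr_ae (Eventually.of_forall fun x => by simp only [hH₂, norm_mul, norm_twist, one_mul])
  exact hM.trans (pow_le_pow_left₀ (by positivity) (add_le_add (Real.sqrt_le_sqrt hA) (Real.sqrt_le_sqrt hB)) 2)


/-! ## §3 The half-step, sup form -/

/-- **THE HALF-STEP WINDOW INEQUALITY, SUP FORM** (see the file header).  Data: cascade parameters (`γ = G ∈ ℕ`,
`δ₀ > 0`, `d > 0`, phase `j` with `N_j ≥ 1`), axes `i ≠ i′`, a continuous input `b` with absolutely summable coefficients, a
finite window `W`, the input cut-off `χ` (support `Sχ`, `‖χ‖ ≤ 1`, `χ(l) ≠ 0 → |l| < L`), per-fibre multipliers `ψ_n`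
(support `Sψ n`, `‖ψ_n‖ ≤ 1` there, plateau `ψ_{k_i}(k_{i′} − l) = 1` for `k ∈ W`, `|l| < L`), reduced strains `λ′` with
`N_j·λ′(k_i) = k_i·G` on `W`, notch widths `D′ ≥ 1` with `N_j·D′(k_i) ≤ |m ± k_iG|` for the multiples `m ∈ Sψ(k_i)` of `N_j`.
Then, with `T = Σ_l χ(l)A^{i′}_l b` and `ρ_n = #{m ∈ Sψ n : N_j ∣ m}·2/(πD′_n) + #Sψ n·|n|G(2e^{1/2}−1)δ_j/N_j` (`…CutoffSup`),
`Σ_{k∈W}‖𝓕(b∘shearMap i i′ (γU_j))(k)‖² ≤ (√(Σ_{n∈F}ρ_n²∫‖A^i_nT‖²) + √(Σ_{n∈F}∫‖A^i_n(b − T)‖²))²`.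
[cite: Grafakos2014, Prop. 3.1.2 (5) and Prop. 3.2.7 (3)] -/
theorem sum_window_sq_norm_halfStep_twist_sup_le (P : CascadeParams) {G : ℕ} (hγ : P.γ = G) (hδ₀ : 0 < P.δ₀)
    (hd : 0 < P.d) {j : ℕ} (hN : 0 < P.N j) {i i' : Fin 2} (hii' : i ≠ i')
    {b : UnitAddTorus (Fin 2) → ℂ} (hb : Continuous b) (hbs : Summable fun k => ‖mFourierCoeff b k‖)
    (W : Finset (Fin 2 → ℤ)) (χ : ℤ → ℂ) (Sχ : Finset ℤ) (hχS : ∀ l, l ∉ Sχ → χ l = 0) (hχ1 : ∀ l, ‖χ l‖ ≤ 1)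
    (L : ℕ) (hχL : ∀ l, χ l ≠ 0 → |l| < L) (ψ : ℤ → ℤ → ℂ) (Sψ : ℤ → Finset ℤ)
    (hψS : ∀ n m, m ∉ Sψ n → ψ n m = 0) (hψb : ∀ n, ∀ m ∈ Sψ n, ‖ψ n m‖ ≤ 1)
    (hψ1 : ∀ k ∈ W, ∀ l : ℤ, |l| < L → ψ (k i) (k i' - l) = 1)
    (lam' : ℤ → ℤ) (hlam : ∀ k ∈ W, (P.N j : ℤ) * lam' (k i) = k i * G)
    (D' : ℤ → ℕ) (hD' : ∀ k ∈ W, 1 ≤ D' (k i))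
    (hnotch : ∀ k ∈ W, ∀ m ∈ Sψ (k i), (P.N j : ℤ) ∣ m →
      (P.N j : ℤ) * D' (k i) ≤ |m + k i * G| ∧ (P.N j : ℤ) * D' (k i) ≤ |m - k i * G|) :
    ∑ k ∈ W, ‖mFourierCoeff (b ∘ shearMap i i' (amp ⟨P.U j, P.U_periodic j, P.contDiff_U (P.δ_pos hδ₀ hd j)⟩ P.γ)) k‖ ^ 2 ≤
      (Real.sqrt (∑ n ∈ W.image (fun k => k i),
          ((((Sψ n).filter fun q : ℤ => (P.N j : ℤ) ∣ q).card : ℝ) * (2 / (π * D' n)) +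
              ((Sψ n).card : ℝ) * (|(n : ℝ)| * G * ((2 * Real.exp (1 / 2) - 1) * P.δ j / P.N j))) ^ 2 *
            ∫ x : UnitAddTorus (Fin 2), ‖∫ s : UnitAddCircle, (fourier (-n) s : ℂ) •
              (∑ l ∈ Sχ, χ l * ∫ s' : UnitAddCircle,
                (fourier (-l) s' : ℂ) • b (x + Pi.single i s + Pi.single i' s'))‖ ^ 2) +
        Real.sqrt (∑ n ∈ W.image (fun k => k i), ∫ x : UnitAddTorus (Fin 2),
          ‖∫ s : UnitAddCircle, (fourier (-n) s : ℂ) •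
            (b (x + Pi.single i s) - ∑ l ∈ Sχ, χ l * ∫ s' : UnitAddCircle,
              (fourier (-l) s' : ℂ) • b (x + Pi.single i s + Pi.single i' s'))‖ ^ 2)) ^ 2 := by
  classical
  set Ψ : ShearProfile := amp ⟨P.U j, P.U_periodic j, P.contDiff_U (P.δ_pos hδ₀ hd j)⟩ P.γ with hΨ
  -- the tracked part of the input and the remainder
  set T : UnitAddTorus (Fin 2) → ℂ := fun x => ∑ l ∈ Sχ, χ l *
    ∫ s : UnitAddCircle, (fourier (-l) s : ℂ) • b (x + Pi.single i' s) with hT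
  have hTc : Continuous T :=
    continuous_finsetSum _ fun l _ => continuous_const.mul (continuous_twistedAxisAvg hb i' l)
  have hTcoef : ∀ k, mFourierCoeff T k = χ (k i') * mFourierCoeff b k := fun k => mFourierCoeff_axisCutoff hb i' hχS k
  have hTs : Summable fun k => ‖mFourierCoeff T k‖ := by
    refine Summable.of_nonneg_of_le (fun k => norm_nonneg _) (fun k => ?_) hbs
    rw [hTcoef k, norm_mul]
    exact mul_le_of_le_one_left (norm_nonneg _) (hχ1 _)
  set θ₂ : UnitAddTorus (Fin 2) → ℂ := fun x => b x - T x with hθ₂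
  have hθ₂c : Continuous θ₂ := hb.sub hTc
  have hsum : (fun x => T x + θ₂ x) = b := by funext x; simp [hθ₂]
  -- the circle kernels and the twist cut-off
  set kψ : ℤ → UnitAddCircle → ℂ := fun n s => ∑ m ∈ Sψ n, ψ n m * fourier (-m) s with hkψ
  have hkψc : ∀ n, Continuous (kψ n) := fun n =>
    continuous_finsetSum _ fun m _ => continuous_const.mul (fourier (-m)).continuous
  set gmid : ℤ → UnitAddCircle → ℂ := fun n bb => ∫ s : UnitAddCircle, kψ n s * twist Ψ n (bb + s) with hgmid
  set grest : ℤ → UnitAddCircle → ℂ := fun n bb => twist Ψ n bb - ∫ s : UnitAddCircle, kψ n s * twist Ψ n (bb + s)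
    with hgrest
  have hgmidc : ∀ n, Continuous (gmid n) := fun n => continuous_circleCutoff (hkψc n) (continuous_twist Ψ n)
  have hgrestc : ∀ n, Continuous (grest n) := fun n =>
    (continuous_twist Ψ n).sub (continuous_circleCutoff (hkψc n) (continuous_twist Ψ n))
  have hsplit : ∀ k ∈ W, ∀ bb, twist Ψ (k i) bb = gmid (k i) bb + grest (k i) bb := by
    intro k _ bb; simp only [hgmid, hgrest]; ring
  -- exact separation
  have hsep : ∀ k ∈ W, ∀ m : ℤ, fourierCoeff (grest (k i)) m * mFourierCoeff T (k - Pi.single i' m) = 0 := by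
    intro k hk m
    rw [hTcoef]
    have e0 : (k - Pi.single i' m : Fin 2 → ℤ) i' = k i' - m := by simp
    rw [e0]
    by_cases hχ0 : χ (k i' - m) = 0
    · rw [hχ0, zero_mul, mul_zero]
    · have hl : |k i' - m| < L := hχL _ hχ0
      have hψm : ψ (k i) m = 1 := by
        have := hψ1 k hk (k i' - m) hl
        rwa [show k i' - (k i' - m) = m by ring] at this
      have hcoef : fourierCoeff (grest (k i)) m = 0 := by
        simp only [hgrest]
        rw [fourierCoeff_sub_of_continuous (continuous_twist Ψ _)
            (continuous_circleCutoff (hkψc _) (continuous_twist Ψ _)),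
          show (fun y : UnitAddCircle => ∫ s : UnitAddCircle, kψ (k i) s * twist Ψ (k i) (y + s)) =
            (fun y : UnitAddCircle => ∫ s : UnitAddCircle, (∑ m' ∈ Sψ (k i), ψ (k i) m' * fourier (-m') s) *
              twist Ψ (k i) (y + s)) from rfl,
          fourierCoeff_circleCutoff (continuous_twist Ψ _) (hψS (k i)) m, hψm, one_mul, sub_self]
      rw [hcoef, zero_mul]
  -- the sup of the cut-offs from `…CutoffSup`
  set ρ : ℤ → ℝ := fun n => (((Sψ n).filter fun q : ℤ => (P.N j : ℤ) ∣ q).card : ℝ) * (2 / (π * D' n)) +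
    ((Sψ n).card : ℝ) * (|(n : ℝ)| * G * ((2 * Real.exp (1 / 2) - 1) * P.δ j / P.N j)) with hρdef
  have hρ : ∀ k ∈ W, ∀ bb : UnitAddCircle, ‖gmid (k i) bb‖ ≤ ρ (k i) := by
    intro k hk bb
    exact norm_circleCutoff_twist_cascade_le P hδ₀ hd hN hγ (k i) (lam' (k i)) (hlam k hk) (Sψ (k i)) (hψb (k i))
      (hD' k hk) (hnotch k hk) bb
  -- the window lemma, sup form
  have hmain := sum_window_sq_norm_comp_shearMap_le_sup hTc hTs hθ₂c hii' Ψ W gmid grest hgmidc hgrestc hsplit hsep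
    (ρ := ρ) hρ
  rw [hsum] at hmain
  exact hmain

end Summit.AnomalousDissipation.AnomalousDissipation.Theorems.SawtoothPulseCascade.K1Window
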